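import Mathlib
import HarnessLib
import Summits.Ventures.LatticeQCDFlow.Exactness.MetropolisSweepExactStepErgodic
import Summits.Ventures.LatticeQCDFlow.Exactness.KickLawsNearIdentity

/-!
# The `U(1)` and `SU(2)` Metropolis sweeps of the engine followed by ANY exact step converge to the Wilson measure from every start

HONEST FRAMING: exact (Metropolis-corrected) sampling algorithms for lattice gauge theory;
figures of merit are autocorrelation/cost numbers at stated couplings and volumes; no
continuum-physics claim.

Venture `LatticeQCDFlow` (cell pub-lqcd), topic `Exactness`, FANOUT row 9 (eng-latcore, the engine's
`u1_2d.sweep_metropolis` (kick `θ ← θ + step·U[−1,1]`) and 4D `updates.sweep_metropolis` on `SU(2)` (Pauli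
kick `exp(i s·σ)`), each followed by ANY exact step — over-relaxation sweeps, microcanonical moves, or
nothing).  NEW WORK of the cell over the tree (`MetropolisSweepExactStepErgodic.lean`:
`metropolisSweep_exactStep_uniformlyErgodic(')` for a step law dominating Haar near `1`;
`KickLawsNearIdentity.lean`: the `U(1)` and `SU(2)` kick laws dominate `a · Haar|_V`; `MetropolisSweepInstances` (the `U(1)` sweep is the generic
sweep, `gibbsProbability_eq_wilsonMeasure`, `wilsonBoltzmann_pinched`)).  Nothing is cited as
a fact; no number is claimed.

* (the kick-law minorants are `KickLawsNearIdentity.lean`) **`wilson_u1MetropolisSweep_exactStep_uniformlyErgodic`**, **`wilson_su2MetropolisSweep_exactStep_uniformlyErgodic`**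
  — torus, continuous representation, any `β`, any kick size, any `nhit ≥ 1`, any scan through every link,
  and ANY Markov kernel `P` leaving the Wilson measure invariant: "sweep, then `P`" satisfies
  `|μ₀Kᵗ(A) − wilsonMeasure(A)| ≤ (1 − ε)^{⌊t/(mm+1)⌋}` from EVERY initial law at every time, and the Wilson
  measure is its unique invariant probability law.

NOT CLAIMED: any value of `mm`, `ε`; a typed `U(1)` over-relaxation SWEEP kernel (the tree has the one-link
reflection `Overrelaxation.lean` / `WilsonOverrelaxation.lean` only — any exact `P` is covered abstractly);
the reverse order (one line each with the primed theorem); floating point.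
-/

noncomputable section

namespace Summit.Ventures.LatticeQCDFlow.Exactness

open MeasureTheory Measure Metric Set Filter Topology Function ProbabilityTheory ProbabilityTheory.Kernel
open Literature.MathematicalPhysics.QuantumFieldTheory
open scoped ENNReal

/-! ## The engine's `U(1)` and `SU(2)` sweeps followed by any exact step -/

section Wilson

variable {d L N : ℕ}

/-- **THE `u1_2d` METROPOLIS SWEEP FOLLOWED BY ANY EXACT STEP CONVERGES TO THE `U(1)` WILSON MEASURE FROM
EVERY START.**  Torus `(ℤ/L)^d`, continuous representation `ρ` of `U(1)`, any real `β`, any `step = s > 0`,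
any `nhit ≥ 1`, any scan through every link, and ANY Markov kernel `P` leaving `wilsonMeasure ρ β` invariant:
with `K = P ∘ₖ u1MetropolisSweep s e^{−βS_W} n Ls` there are `mm` and `ε ∈ (0, 1]` with
`|μ₀Kᵗ(A) − μ_{Λ,β}(A)| ≤ (1 − ε)^{⌊t/(mm+1)⌋}` for EVERY initial law, every `t`, every `A`; and the Wilson
measure is the unique invariant probability law of `K`. -/
theorem wilson_u1MetropolisSweep_exactStep_uniformlyErgodic (ρ : Circle →* Matrix (Fin N) (Fin N) ℂ) [NeZero L]
    (hρ : Continuous ρ) (β : ℝ) {s : ℝ} (hs : 0 < s) {n : ℕ} (hn : 1 ≤ n) {Ls : List (Edge d L)}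
    (hLs : ∀ e, e ∈ Ls) (P : Kernel (GaugeConfig d L Circle) (GaugeConfig d L Circle)) [IsMarkovKernel P]
    (hP : Invariant P (wilsonMeasure (d := d) (L := L) ρ β)) :
    ∃ mm : ℕ, ∃ ε : ℝ, 0 < ε ∧ ε ≤ 1 ∧
      (∀ (μ₀ : Measure (GaugeConfig d L Circle)) [IsProbabilityMeasure μ₀] (t : ℕ) (A : Set (GaugeConfig d L Circle)),
        |((fun ν : Measure (GaugeConfig d L Circle) => ν.bind (P ∘ₖ u1MetropolisSweep s
              (fun U : GaugeConfig d L Circle => Real.exp (-β * wilsonAction ρ U)) n Ls))^[t] μ₀).real A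
            - (wilsonMeasure (d := d) (L := L) ρ β).real A| ≤ (1 - ε) ^ (t / (mm + 1))) ∧
      ∀ (π' : Measure (GaugeConfig d L Circle)) [IsProbabilityMeasure π'],
        Invariant (P ∘ₖ u1MetropolisSweep s (fun U : GaugeConfig d L Circle => Real.exp (-β * wilsonAction ρ U)) n Ls) π' →
          π' = wilsonMeasure (d := d) (L := L) ρ β := by
  obtain ⟨V, hVo, hV1, a, ha, hν⟩ := exists_smul_haar_restrict_le_u1KickLaw hs
  haveI := isProbabilityMeasure_u1KickLaw hs
  haveI := isInvInvariant_u1KickLaw s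
  obtain ⟨s₀, hlo, hhi, hmeas⟩ := wilsonBoltzmann_pinched (d := d) (L := L) ρ hρ β
  rw [← gibbsProbability_eq_wilsonMeasure] at hP ⊢
  rw [u1MetropolisSweep_eq_metropolisSweep]
  exact metropolisSweep_exactStep_uniformlyErgodic ha (hVo.mem_nhds hV1) hν hmeas (Real.exp_pos _) hlo hhi hn hLs P hP

variable {s : ℝ} [Fact (0 < s)]

/-- **THE ENGINE'S `SU(2)` METROPOLIS SWEEP (PAULI KICK) FOLLOWED BY ANY EXACT STEP CONVERGES TO THE `SU(2)`
WILSON MEASURE FROM EVERY START**: torus, continuous representation `ρ`, any `β`, any kick size, any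
`nhit ≥ 1`, any scan through every link, ANY Markov kernel `P` leaving `wilsonMeasure ρ β` invariant (e.g. a
Cabibbo–Marinari / reflection over-relaxation sweep): `|μ₀Kᵗ(A) − μ_{Λ,β}(A)| ≤ (1 − ε)^{⌊t/(mm+1)⌋}` from
every start, unique invariant law, `K = P ∘ₖ metropolisSweep (su2MetropolisKick s) e^{−βS_W} n Ls`. -/
theorem wilson_su2MetropolisSweep_exactStep_uniformlyErgodic
    (ρ : Matrix.specialUnitaryGroup (Fin 2) ℂ →* Matrix (Fin N) (Fin N) ℂ) [NeZero L] (hρ : Continuous ρ) (β : ℝ)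
    {n : ℕ} (hn : 1 ≤ n) {Ls : List (Edge d L)} (hLs : ∀ e, e ∈ Ls)
    (P : Kernel (GaugeConfig d L (Matrix.specialUnitaryGroup (Fin 2) ℂ)) (GaugeConfig d L (Matrix.specialUnitaryGroup (Fin 2) ℂ)))
    [IsMarkovKernel P] (hP : Invariant P (wilsonMeasure (d := d) (L := L) ρ β)) :
    ∃ mm : ℕ, ∃ ε : ℝ, 0 < ε ∧ ε ≤ 1 ∧
      (∀ (μ₀ : Measure (GaugeConfig d L (Matrix.specialUnitaryGroup (Fin 2) ℂ))) [IsProbabilityMeasure μ₀] (t : ℕ)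
          (A : Set (GaugeConfig d L (Matrix.specialUnitaryGroup (Fin 2) ℂ))),
        |((fun ν : Measure (GaugeConfig d L (Matrix.specialUnitaryGroup (Fin 2) ℂ)) =>
              ν.bind (P ∘ₖ metropolisSweep (su2MetropolisKick s)
                (fun U : GaugeConfig d L (Matrix.specialUnitaryGroup (Fin 2) ℂ) => Real.exp (-β * wilsonAction ρ U)) n Ls))^[t]
              μ₀).real A
            - (wilsonMeasure (d := d) (L := L) ρ β).real A| ≤ (1 - ε) ^ (t / (mm + 1))) ∧
      ∀ (π' : Measure (GaugeConfig d L (Matrix.specialUnitaryGroup (Fin 2) ℂ))) [IsProbabilityMeasure π'],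
        Invariant (P ∘ₖ metropolisSweep (su2MetropolisKick s)
          (fun U : GaugeConfig d L (Matrix.specialUnitaryGroup (Fin 2) ℂ) => Real.exp (-β * wilsonAction ρ U)) n Ls) π' →
          π' = wilsonMeasure (d := d) (L := L) ρ β := by
  haveI : ConnectedSpace (Matrix.specialUnitaryGroup (Fin 2) ℂ) :=
    Literature.MathematicalPhysics.QuantumLattice.connectedSpace_specialUnitaryGroup
  obtain ⟨V, hVo, hV1, a, ha, hν⟩ := exists_smul_haar_restrict_le_su2MetropolisKick (s := s)
  obtain ⟨s₀, hlo, hhi, hmeas⟩ := wilsonBoltzmann_pinched (d := d) (L := L) ρ hρ β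
  rw [← gibbsProbability_eq_wilsonMeasure] at hP ⊢
  exact metropolisSweep_exactStep_uniformlyErgodic ha (hVo.mem_nhds hV1) hν hmeas (Real.exp_pos _) hlo hhi hn hLs P hP

end Wilson

end Summit.Ventures.LatticeQCDFlow.Exactness
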